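import Summits.QuantumFields.QCD.Theorems.PauliWegnerSeaFMClosureUnquenchedRepairedC2BetaFloor
import Summits.QuantumFields.QCD.Theorems.PauliWegnerSeaFMClosureUnquenchedClosureC1Aux2

/-!
# Crux `FMClosureUnquenched` (K2, stmt-QuantumFields-11512) — the SPLIT restatement, kernel-checked
# (continuation lead c3, line `von-mises-circles`, 2026-08-17)

What the three earlier lead reports left inconsistent, settled here in Lean:

* `LEAD-c2.md` §4 recommended reading clause (ii) OUTWARD-only downstream as "physically lossless (the excluded
  window is `K a_k |log a_k| → 0` physical units)".  That is an arithmetic slip: the outward guard is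
  `K (1 + |log a_k|) ≤ a_k ‖v‖`, i.e. the excluded window has PHYSICAL radius `K (1 + |log a_k|) → +∞`
  (`tendsto_logWindow_atTop`), so on every ball of fixed physical radius the guard is eventually void
  (`outwardGuard_eventually_false`): an outward-only clause (ii) bounds no continuum two-point function at any
  fixed separation.  The consumers (`closes`, stmt-QuantumFields-9151) need the inward half.
* Hence the honest restatement of K2 is a SPLIT, not a truncation:
  - **K2-out** `CoreOutwardFloor` — the ASFH bootstrap proper: verbatim one-scale `Input`, a coupling floor
    `∃ β₀ > 0, ∀ᶠ k, β₀ ≤ |β_k|` (automatic under asymptotic scaling, `betaFloor_of_hasAsymptoticScaling`,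
    p141628) and the conclusion outward of the log window.  BORN CLOSED modulo the averaged two-star package
    and far stability: `coreOutwardFloor_of_twoStarBounds_farStability` (from the landed `closure_from_betaFloor`).
  - **K2-in** `CoreInward` — decay INSIDE every log window `a_k ‖v‖ ≤ K (1 + |log a_k|)` at a physical rate
    with a k-uniform constant (for each `K` its own exponent `s`).  NEW CRUX: the only mechanism on record is
    radial log-convexity from reflection positivity plus a k-uniform a-priori bound at `v = 0`, available on
    the RP locus (even `N_f`, pairwise-degenerate masses) — card `transfer-logconvex-inward` / line
    `gamma5-square-positivity`; off the locus (`N_f = 3`, split masses) nothing is known.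
  - `conclusion_of_outward_of_inward`: K2-out ∧ K2-in give the crux's `Conclusion` VERBATIM (exponents merged
    by the landed Lyapunov lowering `c1_cruxMoment_rpow_le`), and `clauseII_of_split` has exactly the shape in
    which `PauliWegnerSea.closes` consumes K2 (`N_f ≤ 16`, `(reg.scheme 0 0 0).HasAsymptoticScaling` from
    `ChiralOneScaleTrajectory`): the deciding theorem needs a three-line edit, stmt-9151 needs NO change.

Nothing here is a new obligation of the crux as typed; `Input`, `Conclusion`, `cruxMoment`, `bareMass`,
`TwoStarBounds`, `FarStability` are the landed definitions (`…FMClosureUnquenchedDefs`, p97650).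
References: Aizenman–Schenker–Friedrich–Hundertmark, CMP 224 (2001) 219, Thm 2 [AizenmanEtAl2001].
-/

noncomputable section

namespace Summit.QuantumFields.QCD.Cruxes.FMClosureUnquenched.Split

open scoped BigOperators Topology
open MeasureTheory Filter
open Literature.MathematicalPhysics.QuantumFieldTheory Literature.MathematicalPhysics.QuantumLattice
  Literature.Probability.LatticeModels
open Summit.QuantumFields.QCD.Theorems.VonMisesCircles Summit.QuantumFields.QCD.Theorems.VonMisesCirclesC1
  Summit.QuantumFields.QCD.Theorems.VonMisesCirclesC2

/-! ## 1. The two halves of clause (ii) -/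

/-- **Outward conclusion** (verbatim `CoreOutward`'s consequent, lead c2): clause (ii) for
`K (1 + |log a_k|) ≤ a_k ‖v‖`, one existential constant `K`. -/
def ConclusionOutward (Nf : ℕ) (reg : QCDRegularisation Nf) (m : Fin Nf → ℝ) : Prop :=
  ∃ s δ C K : ℝ, 0 < s ∧ s < 1 ∧ 0 < δ ∧ ∀ᶠ k in atTop, ∀ S : ℕ, reg.L k ≤ S →
    ∀ (f : Fin Nf) (v : Literature.Probability.LatticeModels.Site 4), v ∈ box 4 S →
      K * (1 + |Real.log (reg.a k)|) ≤ reg.a k * ‖v‖ →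
        cruxMoment Nf (reg.β k) (bareMass reg m k) S f v s ≤ C * Real.exp (-(δ * (reg.a k * ‖v‖)))

/-- **Inward conclusion** (NEW): inside EVERY log window `a_k ‖v‖ ≤ K (1 + |log a_k|)` the phase-quenched
fractional moment decays at a physical rate with a k-uniform constant (its own exponent `s` per `K`). -/
def ConclusionInward (Nf : ℕ) (reg : QCDRegularisation Nf) (m : Fin Nf → ℝ) : Prop :=
  ∀ K : ℝ, ∃ s δ C : ℝ, 0 < s ∧ s < 1 ∧ 0 < δ ∧ ∀ᶠ k in atTop, ∀ S : ℕ, reg.L k ≤ S →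
    ∀ (f : Fin Nf) (v : Literature.Probability.LatticeModels.Site 4), v ∈ box 4 S →
      reg.a k * ‖v‖ ≤ K * (1 + |Real.log (reg.a k)|) →
        cruxMoment Nf (reg.β k) (bareMass reg m k) S f v s ≤ C * Real.exp (-(δ * (reg.a k * ‖v‖)))

/-- **K2-out**: the outward core under a coupling floor, for the one-scale input AS TYPED. -/
def CoreOutwardFloor : Prop :=
  ∀ (Nf : ℕ) (reg : QCDRegularisation Nf) (m : Fin Nf → ℝ), (∀ f, 0 < m f) →
    (∃ β₀ : ℝ, 0 < β₀ ∧ ∀ᶠ k in atTop, β₀ ≤ |reg.β k|) → Input Nf reg m → ConclusionOutward Nf reg m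

/-- **K2-in**: the inward core (the route's inward-interpolation crux). -/
def CoreInward : Prop :=
  ∀ (Nf : ℕ) (reg : QCDRegularisation Nf) (m : Fin Nf → ℝ), (∀ f, 0 < m f) →
    Input Nf reg m → ConclusionInward Nf reg m

/-! ## 2. Merging the halves into the crux's `Conclusion` verbatim -/

/-- One-region step: a decay bound at exponent `sᵢ` passes to every smaller exponent `s` (Lyapunov lowering under the
phase-quenched probability measure), with constant `max Cᵢ 1` and rate `δᵢ s / sᵢ`. -/
theorem lower_decay {Nf : ℕ} {s sᵢ δᵢ Cᵢ : ℝ} (hs0 : 0 < s) (hsi1 : sᵢ ≤ 1) (hle : s ≤ sᵢ)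
    (β : ℝ) (mq : Fin Nf → ℝ) (S : ℕ) (f : Fin Nf) (v : Literature.Probability.LatticeModels.Site 4)
    (t : ℝ) (h : cruxMoment Nf β mq S f v sᵢ ≤ Cᵢ * Real.exp (-(δᵢ * t))) :
    cruxMoment Nf β mq S f v s ≤ max Cᵢ 1 * Real.exp (-(δᵢ * (s / sᵢ) * t)) := by
  have hsi : 0 < sᵢ := lt_of_lt_of_le hs0 hle
  have hr0 : 0 < s / sᵢ := div_pos hs0 hsi
  have hr1 : s / sᵢ ≤ 1 := (div_le_one hsi).mpr hle
  have hC1 : (1 : ℝ) ≤ max Cᵢ 1 := le_max_right _ _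
  have hC0 : 0 ≤ max Cᵢ 1 := zero_le_one.trans hC1
  have h' : cruxMoment Nf β mq S f v sᵢ ≤ max Cᵢ 1 * Real.exp (-(δᵢ * t)) :=
    h.trans (mul_le_mul_of_nonneg_right (le_max_left _ _) (Real.exp_pos _).le)
  calc cruxMoment Nf β mq S f v s
      ≤ (cruxMoment Nf β mq S f v sᵢ) ^ (s / sᵢ) := c1_cruxMoment_rpow_le β mq S f v hs0 hle hsi1
    _ ≤ (max Cᵢ 1 * Real.exp (-(δᵢ * t))) ^ (s / sᵢ) :=
        Real.rpow_le_rpow (c1_cruxMoment_nonneg β mq S f v sᵢ) h' hr0.le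
    _ = (max Cᵢ 1) ^ (s / sᵢ) * Real.exp (-(δᵢ * (s / sᵢ) * t)) := by
        rw [Real.mul_rpow hC0 (Real.exp_pos _).le, ← Real.exp_mul]
        congr 2
        ring
    _ ≤ max Cᵢ 1 * Real.exp (-(δᵢ * (s / sᵢ) * t)) := by
        apply mul_le_mul_of_nonneg_right _ (Real.exp_pos _).le
        calc (max Cᵢ 1) ^ (s / sᵢ) ≤ (max Cᵢ 1) ^ (1 : ℝ) := Real.rpow_le_rpow_of_exponent_le hC1 hr1
          _ = max Cᵢ 1 := Real.rpow_one _

/-- **K2-out ∧ K2-in ⇒ clause (ii) verbatim** for one `(N_f, reg, m)`: the outward half supplies its window constant `K`,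
the inward half is invoked at that `K`, the exponents are merged at `s = min s₁ s₂`, `δ = min`, `C = max`. -/
theorem conclusion_of_outward_of_inward {Nf : ℕ} (reg : QCDRegularisation Nf) (m : Fin Nf → ℝ)
    (hout : ConclusionOutward Nf reg m) (hin : ConclusionInward Nf reg m) : Conclusion Nf reg m := by
  obtain ⟨s₁, δ₁, C₁, K, hs₁, hs₁1, hδ₁, hev₁⟩ := hout
  obtain ⟨s₂, δ₂, C₂, hs₂, hs₂1, hδ₂, hev₂⟩ := hin K
  have hs0 : 0 < min s₁ s₂ := lt_min hs₁ hs₂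
  refine ⟨min s₁ s₂, min (δ₁ * (min s₁ s₂ / s₁)) (δ₂ * (min s₁ s₂ / s₂)), max (max C₁ 1) (max C₂ 1), hs0,
    lt_of_le_of_lt (min_le_left _ _) hs₁1,
    lt_min (mul_pos hδ₁ (div_pos hs0 hs₁)) (mul_pos hδ₂ (div_pos hs0 hs₂)), ?_⟩
  filter_upwards [hev₁, hev₂] with k hk₁ hk₂ S hS f v hv
  have ht : 0 ≤ reg.a k * ‖v‖ := mul_nonneg (reg.a_pos k).le (norm_nonneg v)
  have hM : 0 ≤ max (max C₁ 1) (max C₂ 1) :=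
    le_trans (zero_le_one.trans (le_max_right _ _)) (le_max_left _ _)
  rcases le_total (K * (1 + |Real.log (reg.a k)|)) (reg.a k * ‖v‖) with hfar | hnear
  · calc cruxMoment Nf (reg.β k) (bareMass reg m k) S f v (min s₁ s₂)
        ≤ max C₁ 1 * Real.exp (-(δ₁ * (min s₁ s₂ / s₁) * (reg.a k * ‖v‖))) :=
          lower_decay hs0 hs₁1.le (min_le_left _ _) _ _ S f v _ (hk₁ S hS f v hv hfar)
      _ ≤ max (max C₁ 1) (max C₂ 1) *
            Real.exp (-(min (δ₁ * (min s₁ s₂ / s₁)) (δ₂ * (min s₁ s₂ / s₂)) * (reg.a k * ‖v‖))) := by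
          apply mul_le_mul (le_max_left _ _) _ (Real.exp_pos _).le hM
          exact Real.exp_le_exp.mpr (neg_le_neg (mul_le_mul_of_nonneg_right (min_le_left _ _) ht))
  · calc cruxMoment Nf (reg.β k) (bareMass reg m k) S f v (min s₁ s₂)
        ≤ max C₂ 1 * Real.exp (-(δ₂ * (min s₁ s₂ / s₂) * (reg.a k * ‖v‖))) :=
          lower_decay hs0 hs₂1.le (min_le_right _ _) _ _ S f v _ (hk₂ S hS f v hv hnear)
      _ ≤ max (max C₁ 1) (max C₂ 1) *
            Real.exp (-(min (δ₁ * (min s₁ s₂ / s₁)) (δ₂ * (min s₁ s₂ / s₂)) * (reg.a k * ‖v‖))) := by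
          apply mul_le_mul (le_max_right _ _) _ (Real.exp_pos _).le hM
          exact Real.exp_le_exp.mpr (neg_le_neg (mul_le_mul_of_nonneg_right (min_le_right _ _) ht))

/-! ## 3. K2-out is born closed modulo the averaged two-star package and far stability -/

/-- **K2-out from `TwoStarBounds` and `FarStability`** (landed `closure_from_betaFloor`, p141628, with the landed
`collarResolventBounds_holds` p77083 and `hoppingDecay_holds` p75265): NO cofactor domination, input AS TYPED. -/
theorem coreOutwardFloor_of_twoStarBounds_farStability
    (hT : ∀ Nf : ℕ, TwoStarBounds Nf) (hF : ∀ Nf : ℕ, FarStability Nf) : CoreOutwardFloor := by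
  intro Nf reg m _ hβ hIn
  obtain ⟨s, δ, C, K₀, ℓ₀, hs0, hs1, hδ, _hC, hwin, -, hdec⟩ :=
    closure_from_betaFloor Nf reg m (hT Nf) (hF Nf) collarResolventBounds_holds (hoppingDecay_holds Nf) hβ hIn
  refine ⟨s, δ, C, K₀, hs0, hs1, hδ, ?_⟩
  filter_upwards [hwin, hdec] with k hkwin hk S hS f v hv hfar
  have hℓ : (ℓ₀ k f : ℝ) ≤ ‖v‖ := by
    have ha : 0 < reg.a k := reg.a_pos k
    have h1 : (ℓ₀ k f : ℝ) * reg.a k ≤ reg.a k * ‖v‖ := (hkwin f).trans hfar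
    nlinarith
  exact hk S hS f v hv hℓ

/-! ## 4. The split closes the crux's core on asymptotically free trajectories -/

/-- **K2-out ∧ K2-in ⇒ (floor → Input → Conclusion)** for every `(N_f, reg, m > 0)`. -/
theorem core_floor_of_split (hout : CoreOutwardFloor) (hin : CoreInward) :
    ∀ (Nf : ℕ) (reg : QCDRegularisation Nf) (m : Fin Nf → ℝ), (∀ f, 0 < m f) →
      (∃ β₀ : ℝ, 0 < β₀ ∧ ∀ᶠ k in atTop, β₀ ≤ |reg.β k|) → Input Nf reg m → Conclusion Nf reg m :=
  fun Nf reg m hm hβ hIn =>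
    conclusion_of_outward_of_inward reg m (hout Nf reg m hm hβ hIn) (hin Nf reg m hm hIn)

/-- **Clause (ii) in the shape `PauliWegnerSea.closes` consumes it**: for `N_f ≤ 16` and a regularisation whose
massless scheme scales asymptotically (both supplied by `ChiralOneScaleTrajectory`, `N_f ∈ {2, 3}`), the averaged
two-star package, far stability and the inward core turn the one-scale input AS TYPED into the crux's `Conclusion`
AS TYPED — what `h₂ h₁ h₃ Nf reg m hm hin` delivers in `closes` today. -/
theorem clauseII_of_split {Nf : ℕ} (hNf : Nf ≤ 16) (hT : ∀ Nf : ℕ, TwoStarBounds Nf)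
    (hF : ∀ Nf : ℕ, FarStability Nf) (hin : CoreInward) (reg : QCDRegularisation Nf)
    (hAS : (reg.scheme 0 0 0).HasAsymptoticScaling) (m : Fin Nf → ℝ) (hm : ∀ f, 0 < m f)
    (hInput : Input Nf reg m) : Conclusion Nf reg m :=
  core_floor_of_split (coreOutwardFloor_of_twoStarBounds_farStability hT hF) hin Nf reg m hm
    (betaFloor_of_hasAsymptoticScaling hNf reg 0 0 0 hAS) hInput

/-- Conversely the crux's core as typed gives both halves trivially (so the split asks for nothing new). -/
theorem split_of_core
    (h : ∀ (Nf : ℕ) (reg : QCDRegularisation Nf) (m : Fin Nf → ℝ), (∀ f, 0 < m f) →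
      Input Nf reg m → Conclusion Nf reg m) : CoreOutwardFloor ∧ CoreInward := by
  refine ⟨fun Nf reg m hm _ hIn => ?_, fun Nf reg m hm hIn K => ?_⟩
  · obtain ⟨s, δ, C, hs0, hs1, hδ, hev⟩ := h Nf reg m hm hIn
    exact ⟨s, δ, C, 1, hs0, hs1, hδ, hev.mono fun k hk S hS f v hv _ => hk S hS f v hv⟩
  · obtain ⟨s, δ, C, hs0, hs1, hδ, hev⟩ := h Nf reg m hm hIn
    exact ⟨s, δ, C, hs0, hs1, hδ, hev.mono fun k hk S hS f v hv _ => hk S hS f v hv⟩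

/-! ## 5. Why the inward half cannot be dropped: the outward guard is void at every fixed physical distance -/

/-- The physical radius `K (1 + |log a_k|)` of the excluded window DIVERGES along every regularisation (`a_k → 0⁺`). -/
theorem tendsto_logWindow_atTop {Nf : ℕ} (reg : QCDRegularisation Nf) {K : ℝ} (hK : 0 < K) :
    Tendsto (fun k => K * (1 + |Real.log (reg.a k)|)) atTop atTop := by
  have h1 : Tendsto reg.a atTop (𝓝[>] 0) :=
    tendsto_nhdsWithin_iff.mpr ⟨reg.tendsto_a, Eventually.of_forall fun k => reg.a_pos k⟩
  have h2 : Tendsto (fun k => Real.log (reg.a k)) atTop atBot := Real.tendsto_log_nhdsGT_zero.comp h1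
  have h3 : Tendsto (fun k => |Real.log (reg.a k)|) atTop atTop := tendsto_abs_atBot_atTop.comp h2
  exact (tendsto_atTop_add_const_left _ 1 h3).const_mul_atTop hK

/-- **On every ball of fixed physical radius `r` the outward guard is eventually false**: an outward-only clause (ii)
says nothing, for all large `k`, about any `v` with `a_k ‖v‖ ≤ r` — hence nothing about a continuum two-point function
at any fixed separation.  (The inward half is where the physics at fixed distance lives.) -/
theorem outwardGuard_eventually_false {Nf : ℕ} (reg : QCDRegularisation Nf) {K : ℝ} (hK : 0 < K) (r : ℝ) :
    ∀ᶠ k in atTop, ∀ v : Literature.Probability.LatticeModels.Site 4,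
      reg.a k * ‖v‖ ≤ r → ¬ (K * (1 + |Real.log (reg.a k)|) ≤ reg.a k * ‖v‖) := by
  filter_upwards [(tendsto_logWindow_atTop reg hK).eventually_gt_atTop r] with k hk v hv h
  exact absurd (h.trans hv) (not_le.mpr hk)

end Summit.QuantumFields.QCD.Cruxes.FMClosureUnquenched.Split

end
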